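import Literature.Analysis.FluidPDE.ElgindiRadialDerivativeCoercivity
import Literature.Analysis.FluidPDE.ElgindiFirstTransportCoercivity
import HarnessLib

/-!
# `𝓗¹` coercivity of Elgindi's operator `𝓛_Γ^T` ([Elgindi2021] Definition 6.10, Corollary 6.11)

Topic `Literature/Analysis/FluidPDE`. Proof file (everything proved, no definitions, no named
facts) on the proof path of the named fact
`Literature.Analysis.FluidPDE.Elgindi.ElgindiGhoulMasmoudi2021_stabilityCore`
(`ElgindiStabilityDecomposition.lean`). T. M. Elgindi, Ann. of Math. 194 (2021) =
arXiv:1904.04795 (`[Elgindi2021]`), §6.2 (p. 17 of the held text):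

> "**Definition 6.10.** We define the `𝓗¹` inner product by `(f,g)_{𝓗¹} = 10((D_zf),(D_zg)w²/sin(2θ)^η)
> + 10¹⁰(fw, gw/sin(2θ)^η) + 10¹⁷(fw,gw) + 10²¹((D_θf),(D_θg)w²/sin(2θ)^γ)`, which induces a norm
> equivalent to `|f|²_{𝓗¹} = Σ_{k=0}^{1}|(D_z)^kf·w/√(sin(2θ)^η)|² + |(D_θ)f·w/√(sin(2θ)^γ)|²`.
> **Corollary 6.11.** Let `η = 99/100` and `α < 10⁻¹⁴`. Then, `(𝓛_Γ^T(f), f)_{𝓗¹} ≥ |f|²_{𝓗¹}`."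

Exactly that combination of the vendored Propositions 6.4 (`transportL2Coercivity`), 6.5
(`thetaDerivativeCoercivity`), 6.7 (`etaWeightedCoercivity`) and 6.9 (`radialDerivativeCoercivity`):
`10·(¼Z − 10⁸(Y + X)) + 10¹⁰·((1/5)X − 10⁶A) + 10¹⁷·((1/5)A − 100Y_w) + 10²¹·((¼ − α)Y − 10⁷αA)
≥ Z + X + Y` for `α ≤ 10⁻¹⁴` (`Y_w ≤ Y`, `A ≤ X`), written out with the four pairings (the
`𝓗¹` inner product of Definition 6.10 expanded) — for `0 < α ≤ 10⁻¹⁴` and `f ∈ C³` compactly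
supported inside the open strip with `L₁₂(f)(0) = 0`.
-/

noncomputable section

open MeasureTheory Set Function Real Filter
open _root_.Topology

namespace Literature.Analysis.FluidPDE

namespace Elgindi

/-- **Corollary 6.11 (`𝓗¹` coercivity of `𝓛_Γ^T`)** (Elgindi 2021, Definition 6.10 + Corollary 6.11:
"`(f,g)_{𝓗¹} = 10((D_zf),(D_zg)w²/sin(2θ)^η) + 10¹⁰(fw,gw/sin(2θ)^η) + 10¹⁷(fw,gw) +
10²¹((D_θf),(D_θg)w²/sin(2θ)^γ)` … Let `η = 99/100` and `α < 10⁻¹⁴`. Then `(𝓛_Γ^T(f),f)_{𝓗¹} ≥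
|f|²_{𝓗¹}`", `|f|²_{𝓗¹} = |fw/√sin^η|² + |D_zf·w/√sin^η|² + |D_θf·w/√sin^γ|²`), for `0 < α ≤ 10⁻¹⁴`
and `f ∈ C³` compactly supported inside the open strip with `L₁₂(f)(0) = 0`. [cite: Elgindi2021, §6.2 Definition 6.10 and Corollary 6.11 (p. 17 of arXiv:1904.04795)] -/
theorem h1Coercivity {α : ℝ} (hα : 0 < α) (hα14 : α ≤ 1 / 10 ^ 14) {f : ℝ → ℝ → ℝ}
    (hf : ContDiff ℝ 3 (uncurry f)) (hs : HasCompactSupport (uncurry f))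
    (hsub : tsupport (uncurry f) ⊆ strip) (hL0 : L12 f 0 = 0) :
    (∫ p in strip, (f p.1 p.2 * radialWeight p.1) ^ 2 * Real.sin (2 * p.2) ^ (-eta)) +
        (∫ p in strip, (Dz f p.1 p.2 * radialWeight p.1) ^ 2 * Real.sin (2 * p.2) ^ (-eta)) +
        (∫ p in strip, (Dθ f p.1 p.2 * radialWeight p.1) ^ 2 * Real.sin (2 * p.2) ^ (-gammaExp α)) ≤
      10 * (∫ p in strip, Dz (opLΓT α f) p.1 p.2 * Dz f p.1 p.2 * radialWeight p.1 ^ 2 *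
          Real.sin (2 * p.2) ^ (-eta)) +
        10 ^ 10 * (∫ p in strip, opLΓT α f p.1 p.2 * f p.1 p.2 * radialWeight p.1 ^ 2 *
          Real.sin (2 * p.2) ^ (-eta)) +
        10 ^ 17 * (∫ p in strip, opLΓT α f p.1 p.2 * f p.1 p.2 * radialWeight p.1 ^ 2) +
        10 ^ 21 * (∫ p in strip, Dθ (opLΓT α f) p.1 p.2 * Dθ f p.1 p.2 * radialWeight p.1 ^ 2 *
          Real.sin (2 * p.2) ^ (-gammaExp α)) := by
  have hα' : α ≤ 1 / 200 := hα14.trans (by norm_num)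
  have hf2 : ContDiff ℝ 2 (uncurry f) := hf.of_le (by norm_num)
  have h69 := radialDerivativeCoercivity hα hα' hf hs hsub hL0
  have h67 := etaWeightedCoercivity hα hα' hf2 hs hsub hL0
  have h64 := transportL2Coercivity hα.le hα' (hf.of_le (by norm_num)) hs hsub hL0
  have h65 := thetaDerivativeCoercivity hα hα' hf2 hs hsub hL0
  have hYw := integral_sq_Dθ_le_weighted hα.le hf2 hs hsub
  have hAX := integral_sq_le_weighted_eta hf2 hs hsub
  set X : ℝ := ∫ p in strip, (f p.1 p.2 * radialWeight p.1) ^ 2 * Real.sin (2 * p.2) ^ (-eta) with hX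
  set Y : ℝ := ∫ p in strip, (Dθ f p.1 p.2 * radialWeight p.1) ^ 2 * Real.sin (2 * p.2) ^ (-gammaExp α) with hY
  set Z : ℝ := ∫ p in strip, (Dz f p.1 p.2 * radialWeight p.1) ^ 2 * Real.sin (2 * p.2) ^ (-eta) with hZ
  set A : ℝ := ∫ p in strip, (f p.1 p.2 * radialWeight p.1) ^ 2 with hA
  set Yw : ℝ := ∫ p in strip, (Dθ f p.1 p.2 * radialWeight p.1) ^ 2 with hYw'
  have hA0 : 0 ≤ A := integral_nonneg fun p => sq_nonneg _
  have hY0 : 0 ≤ Y := by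
    simp only [hY]
    refine setIntegral_nonneg measurableSet_strip fun p hp => ?_
    have hsθ : 0 < Real.sin (2 * p.2) := Real.sin_pos_of_pos_of_lt_pi (by linarith [hp.2.1]) (by linarith [hp.2.2])
    exact mul_nonneg (sq_nonneg _) (Real.rpow_nonneg hsθ.le _)
  have hZ0 : 0 ≤ Z := by
    simp only [hZ]
    refine setIntegral_nonneg measurableSet_strip fun p hp => ?_
    have hsθ : 0 < Real.sin (2 * p.2) := Real.sin_pos_of_pos_of_lt_pi (by linarith [hp.2.1]) (by linarith [hp.2.2])
    exact mul_nonneg (sq_nonneg _) (Real.rpow_nonneg hsθ.le _)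
  have hαA : α * A ≤ 1 / 10 ^ 14 * A := mul_le_mul_of_nonneg_right hα14 hA0
  have hαY : α * Y ≤ 1 / 10 ^ 14 * Y := mul_le_mul_of_nonneg_right hα14 hY0
  nlinarith [h69, h67, h64, h65, hYw, hAX, hαA, hαY, hA0, hY0, hZ0]

end Elgindi

end Literature.Analysis.FluidPDE
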